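import Summits.HodgeConjecture.HodgeConjecture.Theorems.Ring2WeilCoverageNormTable
import Mathlib.Algebra.Quaternion
import Mathlib.LinearAlgebra.Matrix.Determinant.Basic
import Mathlib.LinearAlgebra.Matrix.Notation
import Mathlib.Tactic.FinCases
import HarnessLib

/-!
# Ring 2 — Weil-type family coverage: THE WEIL DISCRIMINANT OF A TYPE-III FOURFOLD IS THE REDUCED NORM OF ITS
  SKEW-HERMITIAN GRAM MATRIX, frame-free (rank 2, any `𝔻`-basis), and the rows of the three simple type-III members of the
  quasiplatonic census (WEIL-FAMILY-COVERAGE «## b03», block b03.42, cell (xx⁵); part 61)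

research route conditional on HC_CM; not a corollary; Q11.4-sentence-2 already refuted in dim ≥ 3.

SETTING [cite: vanGeemen1994HodgeAV, Lemma 5.2 and (5.4.1)] (the census's LEMMA CK of block b02.26 =
`Ring2.WeilCoverage.lemmaCK_block_det`, and the FRAME-FREE PLACEMENT THEOREM of block b04.10 (A), case `F = ℚ`, `k = 2`).
`𝔻 = (a, c)_ℚ` a definite quaternion algebra (Mathlib's `ℍ[R, a, c]`: `i² = a`, `j² = c`, `k = ij = -ji`), `K = ℚ(i) = ℚ(√a) ⊂ 𝔻`,
`V = 𝔻²` a left `𝔻`-module (the `H₁(X, ℚ)` of an abelian fourfold `X` of type III, `𝔻 = End⁰ X`, `m = dim_𝔻 V = 2`), and the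
Riemann form `E_T(x, y) = Trd(Σ_{s,t} x_s T_{st} ȳ_t)` of a polarization, `T = [[β₁, γ], [-γ̄, β₂]]` SKEW-HERMITIAN (`β₁, β₂` pure) —
the Rosati involution of a type-III polarization is quaternion conjugation [cite: MumfordAV1970, §21 Thm. 2], so `E_T(u·x, y) =
E_T(x, ū·y)`.  van Geemen's `K`-hermitian Weil form is `H(x, y) = E_T(i·x, y) + i·E_T(x, y)` and `δ_K(X) = [det Ψ] ∈ ℚˣ/Nm(Kˣ)`,
`Ψ` its Gram matrix on the `K`-basis `(1,0), (j,0), (0,1), (0,j)` of `V`.  To keep ONE commutative coefficient ring we write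
`a = α²` (`α` a free variable; specialise `α ↦ √a ∈ K`), so all statements are polynomial identities over a commutative ring `R`.

* §1 `typeIII_pairing_alt`, `typeIII_pairing_lmul` — `E_T` is alternating and `𝔻` acts through conjugation (any ring).
* §2 `typeIII_weilGram_apply` — the sixteen entries of `Ψ` (each binomial in `α`), and `typeIII_weilGram_symm` (`Ψ` is hermitian:
  `Ψᵀ = Ψ(α ↦ -α)`).
* §3 **`typeIII_weilGram_det`**: `det Ψ = 16 α⁴ c² · Nrd_{M₂(𝔻)}(T)` with **`Nrd_{M₂(𝔻)}(T) = Nrd β₁ · Nrd β₂ + Nrd(γ)² +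
  Trd(β₂ γ̄ β₁ γ)`** (the reduced norm of the `2 × 2` quaternion matrix `T`; Dieudonné), i.e. `det Ψ = (4 α² c)² · Nrd(T)`
  (`typeIII_weilGram_det_eq_sq_mul`): **`δ_K(X) ≡ Nrd(T) = disc T` in `ℚˣ/Nm(Kˣ)` FOR EVERY imaginary quadratic `K ⊂ 𝔻`
  and every `𝔻`-basis** (the rank-2 case of LEMMA CK ∕ b04.10 (A) WITHOUT diagonalising `T`; `typeIII_weilGram_det_diag`
  recovers `(4αc·α)²·Nrd β₁ Nrd β₂` at `γ = 0`).  `disc T` is also the discriminant of the adjoint (orthogonal) involution of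
  `End_𝔻 V`, whose even Clifford algebra has centre `ℚ(√disc T)` = the field of definition of the two `SL₂`-factors of the
  Hodge group `Aut_𝔻(V, T)° ≃ SO₄`-form [cite: KnusEtAl1998, (7.2) and Thm. (8.10)] — for the census members this
  field was certified from Frobenius in block b03.41: `ℚ(√5)`, `ℚ(√2)`, `ℚ(√6)`.
* §4 THE THREE MEMBERS (b03.40 ∕ b03.41: `B ~ X²`, `X` simple of type III, `End⁰ X = 𝔻`): #10 `(10; 2,4,5,5,6,8)`:
  `𝔻 = D_{5,∞} ≅ (-2,-5)_ℚ`, `disc T ≡ 5`; #26 `(12; 2,3,6,6,9,10)`: `D_{3,∞} ≅ (-1,-3)_ℚ`, `disc T ≡ 2`; #29 `(12; 3,4,6,6,8,9)`: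
  `D_{2,∞} ≅ (-1,-1)_ℚ`, `disc T ≡ 6`.  Explicit square roots (`√-3 ∈ 𝔻` in all three — the hypothesis of
  [cite: Abdulali2002TypeIII, Cor. 4.3]: general Hodge conjecture for ALL POWERS of `X` —, `√-5`, `√-1`, `√-2`), and the ROWS
  `(2, K, [disc T])` of the fourfold table these points lie on: SPLIT (`δ_K = 1`, [cite: Markman2023GeneralizedKummers, Thm. 1.3]
  applies) for `K = ℚ(√-5)` (#10), `ℚ(√-1)` (#26), `ℚ(√-2), ℚ(√-5), ℚ(√-6)` (#29); NON-split for `K = ℚ(√-3)` (all three: `5, 2, 6 ∉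
  Nm ℚ(√-3)ˣ`; the #26 class `[2] ≠ split` is the tree's `SigmaDataWeilRowsB.twoA6_eta_8_4_8_7_3_3_3_3_o1_gram_ne_split`, reused)
  and `K = ℚ(√-1)` (#29: `6 ∉ Nm ℚ(i)ˣ`) — one line each over the tree's norm tables (ring2-b02 ∕ ring2-b04; not restated).
No `def`, no named fact, no `sorry`; nothing in this file is a statement about Hodge classes; `HC_CM` is used nowhere.
-/

noncomputable section

set_option linter.dupNamespace false

open Quaternion
open Literature.AlgebraicGeometry.Motives
open Literature.AlgebraicGeometry.VanGeemen1994
open Summit.HodgeConjecture.HodgeConjecture.Ring2.Hypotheses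
open Summit.HodgeConjecture.HodgeConjecture.Ring2.WeilCoverage

namespace Summit.HodgeConjecture.HodgeConjecture.Ring2.WeilCoverageCM

section TypeIIIDisc

variable {R : Type*} [CommRing R]

/-! ### §1 The Riemann form `E_T` of a skew-hermitian `T ∈ M₂(𝔻)`: alternating, `𝔻`-balanced through conjugation -/

/-- **`E_T` is alternating**: for `T = [[β₁, γ], [-γ̄, β₂]]` with `β₁, β₂` pure, `Trd(Σ x_s T_{st} x̄_t) = 0` for every
`x = (x₁, x₂) ∈ 𝔻²` — a polynomial identity over any commutative ring.
research route conditional on HC_CM; not a corollary; Q11.4-sentence-2 already refuted in dim ≥ 3. [cite: vanGeemen1994HodgeAV, Lemma 5.2] -/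
theorem typeIII_pairing_alt (a c p₁ q₁ r₁ p₂ q₂ r₂ : R) (γ x₁ x₂ : ℍ[R,a,c]) :
    2 * (x₁ * ⟨0, p₁, q₁, r₁⟩ * star x₁ + x₁ * γ * star x₂ - x₂ * star γ * star x₁ + x₂ * ⟨0, p₂, q₂, r₂⟩ * star x₂).re = 0 := by
  cases γ; cases x₁; cases x₂
  simp
  ring

/-- **`𝔻` acts through conjugation** (Rosati = quaternion conjugation on a type-III `End⁰`): `E_T(u·x, y) = E_T(x, ū·y)`,
i.e. `Trd(Σ (u x_s) T_{st} ȳ_t) = Trd(Σ x_s T_{st} conj(ū y_t))`, for all `u, x, y` — over any commutative ring.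
research route conditional on HC_CM; not a corollary; Q11.4-sentence-2 already refuted in dim ≥ 3. [cite: MumfordAV1970, §21 Thm. 2] -/
theorem typeIII_pairing_lmul (a c : R) (T₁₁ T₁₂ T₂₁ T₂₂ u x₁ x₂ y₁ y₂ : ℍ[R,a,c]) :
    (u * x₁ * T₁₁ * star y₁ + u * x₁ * T₁₂ * star y₂ + u * x₂ * T₂₁ * star y₁ + u * x₂ * T₂₂ * star y₂).re =
      (x₁ * T₁₁ * star (star u * y₁) + x₁ * T₁₂ * star (star u * y₂) + x₂ * T₂₁ * star (star u * y₁) +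
        x₂ * T₂₂ * star (star u * y₂)).re := by
  cases T₁₁; cases T₁₂; cases T₂₁; cases T₂₂; cases u; cases x₁; cases x₂; cases y₁; cases y₂
  simp
  ring

/-! ### §2 The Gram matrix `Ψ` of van Geemen's `K`-hermitian form on the `K`-basis `(1,0), (j,0), (0,1), (0,j)` -/

/-- **The sixteen entries of `Ψ`.**  With `a = α²`, `β₁ = p₁ i + q₁ j + r₁ k`, `β₂ = p₂ i + q₂ j + r₂ k`, `γ = g₀ + g₁ i + g₂ j + g₃ k`,
`X = (1, j, 0, 0)`, `Y = (0, 0, 1, j)` (the two coordinates of the basis vectors `e_s = (X_s, Y_s)`), the entry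
`Ψ_{st} = E_T(i·e_s, e_t) + α·E_T(e_s, e_t)` (the `K = R[α]`-valued Weil form, `α = i`) is the displayed binomial.
research route conditional on HC_CM; not a corollary; Q11.4-sentence-2 already refuted in dim ≥ 3. [cite: vanGeemen1994HodgeAV, Lemma 5.2] -/
theorem typeIII_weilGram_apply (α c p₁ q₁ r₁ p₂ q₂ r₂ g₀ g₁ g₂ g₃ : R) (s t : Fin 4) :
    2 * (((⟨0, 1, 0, 0⟩ : ℍ[R,α^2,c]) * (![1, ⟨0, 0, 1, 0⟩, 0, 0] s) * ⟨0, p₁, q₁, r₁⟩ * star (![1, ⟨0, 0, 1, 0⟩, 0, 0] t) +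
          ⟨0, 1, 0, 0⟩ * (![1, ⟨0, 0, 1, 0⟩, 0, 0] s) * ⟨g₀, g₁, g₂, g₃⟩ * star (![0, 0, 1, ⟨0, 0, 1, 0⟩] t) -
          ⟨0, 1, 0, 0⟩ * (![0, 0, 1, ⟨0, 0, 1, 0⟩] s) * star ⟨g₀, g₁, g₂, g₃⟩ * star (![1, ⟨0, 0, 1, 0⟩, 0, 0] t) +
          ⟨0, 1, 0, 0⟩ * (![0, 0, 1, ⟨0, 0, 1, 0⟩] s) * ⟨0, p₂, q₂, r₂⟩ * star (![0, 0, 1, ⟨0, 0, 1, 0⟩] t)).re) +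
      α * (2 * (((![1, ⟨0, 0, 1, 0⟩, 0, 0] s : ℍ[R,α^2,c]) * ⟨0, p₁, q₁, r₁⟩ * star (![1, ⟨0, 0, 1, 0⟩, 0, 0] t) +
          (![1, ⟨0, 0, 1, 0⟩, 0, 0] s) * ⟨g₀, g₁, g₂, g₃⟩ * star (![0, 0, 1, ⟨0, 0, 1, 0⟩] t) -
          (![0, 0, 1, ⟨0, 0, 1, 0⟩] s) * star ⟨g₀, g₁, g₂, g₃⟩ * star (![1, ⟨0, 0, 1, 0⟩, 0, 0] t) +
          (![0, 0, 1, ⟨0, 0, 1, 0⟩] s) * ⟨0, p₂, q₂, r₂⟩ * star (![0, 0, 1, ⟨0, 0, 1, 0⟩] t)).re)) =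
      !![2*α^2*p₁, -2*α^2*c*r₁ - 2*α*c*q₁, 2*α^2*g₁ + 2*α*g₀, -2*α^2*c*g₃ - 2*α*c*g₂;
         -2*α^2*c*r₁ + 2*α*c*q₁, 2*α^2*c*p₁, -2*α^2*c*g₃ + 2*α*c*g₂, 2*α^2*c*g₁ - 2*α*c*g₀;
         2*α^2*g₁ - 2*α*g₀, -2*α^2*c*g₃ - 2*α*c*g₂, 2*α^2*p₂, -2*α^2*c*r₂ - 2*α*c*q₂;
         -2*α^2*c*g₃ + 2*α*c*g₂, 2*α^2*c*g₁ + 2*α*c*g₀, -2*α^2*c*r₂ + 2*α*c*q₂, 2*α^2*c*p₂] s t := by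
  fin_cases s <;> fin_cases t <;>
    simp <;>
    ring

/-- **`Ψ` is hermitian**: `Ψ_{ts} = \overline{Ψ_{st}}`, complex conjugation being `α ↦ -α`.
research route conditional on HC_CM; not a corollary; Q11.4-sentence-2 already refuted in dim ≥ 3. [cite: vanGeemen1994HodgeAV, Lemma 5.2 (2)] -/
theorem typeIII_weilGram_symm (α c p₁ q₁ r₁ p₂ q₂ r₂ g₀ g₁ g₂ g₃ : R) (s t : Fin 4) :
    !![2*α^2*p₁, -2*α^2*c*r₁ - 2*α*c*q₁, 2*α^2*g₁ + 2*α*g₀, -2*α^2*c*g₃ - 2*α*c*g₂;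
       -2*α^2*c*r₁ + 2*α*c*q₁, 2*α^2*c*p₁, -2*α^2*c*g₃ + 2*α*c*g₂, 2*α^2*c*g₁ - 2*α*c*g₀;
       2*α^2*g₁ - 2*α*g₀, -2*α^2*c*g₃ - 2*α*c*g₂, 2*α^2*p₂, -2*α^2*c*r₂ - 2*α*c*q₂;
       -2*α^2*c*g₃ + 2*α*c*g₂, 2*α^2*c*g₁ + 2*α*c*g₀, -2*α^2*c*r₂ + 2*α*c*q₂, 2*α^2*c*p₂] t s =
    !![2*(-α)^2*p₁, -2*(-α)^2*c*r₁ - 2*(-α)*c*q₁, 2*(-α)^2*g₁ + 2*(-α)*g₀, -2*(-α)^2*c*g₃ - 2*(-α)*c*g₂;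
       -2*(-α)^2*c*r₁ + 2*(-α)*c*q₁, 2*(-α)^2*c*p₁, -2*(-α)^2*c*g₃ + 2*(-α)*c*g₂, 2*(-α)^2*c*g₁ - 2*(-α)*c*g₀;
       2*(-α)^2*g₁ - 2*(-α)*g₀, -2*(-α)^2*c*g₃ - 2*(-α)*c*g₂, 2*(-α)^2*p₂, -2*(-α)^2*c*r₂ - 2*(-α)*c*q₂;
       -2*(-α)^2*c*g₃ + 2*(-α)*c*g₂, 2*(-α)^2*c*g₁ + 2*(-α)*c*g₀, -2*(-α)^2*c*r₂ + 2*(-α)*c*q₂, 2*(-α)^2*c*p₂] s t := by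
  fin_cases s <;> fin_cases t <;> simp <;> ring

/-! ### §3 `det Ψ = 16 α⁴ c² · Nrd_{M₂(𝔻)}(T)` -/

/-- `Fin.succAbove 2 2 = 3` in `Fin 4` (index bookkeeping for `det_fin_four`). [folklore] -/
private theorem succAbove_two_two : Fin.succAbove (2 : Fin 4) (2 : Fin 3) = 3 := by decide
/-- `Fin.succAbove 3 2 = 2` in `Fin 4`. [folklore] -/
private theorem succAbove_three_two : Fin.succAbove (3 : Fin 4) (2 : Fin 3) = 2 := by decide
/-- `Fin.succAbove 1 2 = 3` in `Fin 4`. [folklore] -/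
private theorem succAbove_one_two : Fin.succAbove (1 : Fin 4) (2 : Fin 3) = 3 := by decide

/-- Leibniz expansion of a `4 × 4` determinant. [folklore] -/
private theorem det_fin_four (A : Matrix (Fin 4) (Fin 4) R) :
    A.det =
      A 0 0 * A 1 1 * A 2 2 * A 3 3 - A 0 0 * A 1 1 * A 2 3 * A 3 2
        - A 0 0 * A 1 2 * A 2 1 * A 3 3 + A 0 0 * A 1 2 * A 2 3 * A 3 1
        + A 0 0 * A 1 3 * A 2 1 * A 3 2 - A 0 0 * A 1 3 * A 2 2 * A 3 1
        - A 0 1 * A 1 0 * A 2 2 * A 3 3 + A 0 1 * A 1 0 * A 2 3 * A 3 2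
        + A 0 1 * A 1 2 * A 2 0 * A 3 3 - A 0 1 * A 1 2 * A 2 3 * A 3 0
        - A 0 1 * A 1 3 * A 2 0 * A 3 2 + A 0 1 * A 1 3 * A 2 2 * A 3 0
        + A 0 2 * A 1 0 * A 2 1 * A 3 3 - A 0 2 * A 1 0 * A 2 3 * A 3 1
        - A 0 2 * A 1 1 * A 2 0 * A 3 3 + A 0 2 * A 1 1 * A 2 3 * A 3 0
        + A 0 2 * A 1 3 * A 2 0 * A 3 1 - A 0 2 * A 1 3 * A 2 1 * A 3 0
        - A 0 3 * A 1 0 * A 2 1 * A 3 2 + A 0 3 * A 1 0 * A 2 2 * A 3 1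
        + A 0 3 * A 1 1 * A 2 0 * A 3 2 - A 0 3 * A 1 1 * A 2 2 * A 3 0
        - A 0 3 * A 1 2 * A 2 0 * A 3 1 + A 0 3 * A 1 2 * A 2 1 * A 3 0 := by
  rw [Matrix.det_succ_row_zero]
  simp [Fin.sum_univ_succ, Matrix.det_fin_three, succAbove_two_two, succAbove_three_two, succAbove_one_two]
  ring

/-- **The reduced norm of `T = [[β₁, γ], [-γ̄, β₂]] ∈ M₂(𝔻)` in closed form**: Dieudonné's `Nrd(T) = Nrd(β₁)·Nrd(β₂ + γ̄ β₁⁻¹ γ)`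
clears to the POLYNOMIAL `Nrd β₁ · Nrd β₂ + Nrd(γ)² + Trd(β₂ γ̄ β₁ γ)`; here: `Nrd(β₁) · Nrd(T) = Nrd(Nrd(β₁) β₂ - γ̄ β₁ γ)`
(`β₁⁻¹ = -β₁/Nrd β₁` for `β₁` pure), with `Nrd x = (x x̄).re`, `Trd x = 2 x.re` — over any commutative ring.
research route conditional on HC_CM; not a corollary; Q11.4-sentence-2 already refuted in dim ≥ 3. [cite: KnusEtAl1998, (7.2)] -/
theorem typeIII_nrd_M2_formula (a c p₁ q₁ r₁ p₂ q₂ r₂ : R) (γ : ℍ[R,a,c]) :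
    ((⟨0, p₁, q₁, r₁⟩ : ℍ[R,a,c]) * star ⟨0, p₁, q₁, r₁⟩).re *
        (((⟨0, p₁, q₁, r₁⟩ : ℍ[R,a,c]) * star ⟨0, p₁, q₁, r₁⟩).re * ((⟨0, p₂, q₂, r₂⟩ : ℍ[R,a,c]) * star ⟨0, p₂, q₂, r₂⟩).re + (γ * star γ).re ^ 2 +
          2 * ((⟨0, p₂, q₂, r₂⟩ : ℍ[R,a,c]) * star γ * ⟨0, p₁, q₁, r₁⟩ * γ).re) =
      ((((⟨0, p₁, q₁, r₁⟩ : ℍ[R,a,c]) * star ⟨0, p₁, q₁, r₁⟩).re • (⟨0, p₂, q₂, r₂⟩ : ℍ[R,a,c]) - star γ * ⟨0, p₁, q₁, r₁⟩ * γ) *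
        star (((⟨0, p₁, q₁, r₁⟩ : ℍ[R,a,c]) * star ⟨0, p₁, q₁, r₁⟩).re • (⟨0, p₂, q₂, r₂⟩ : ℍ[R,a,c]) - star γ * ⟨0, p₁, q₁, r₁⟩ * γ)).re := by
  cases γ
  simp
  ring

/-- **THE FRAME-FREE RANK-2 IDENTITY** (LEMMA CK of census block b02.26 ∕ the frame-free placement theorem b04.10 (A) for `F = ℚ`,
`k = 2`, without diagonalising `T`): **`det Ψ = 16 α⁴ c² · (Nrd β₁ · Nrd β₂ + Nrd(γ)² + Trd(β₂ γ̄ β₁ γ))` = `16 α⁴ c² · Nrd_{M₂(𝔻)}(T)`**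
in `R[α]` with `a = α²`; hence, specialising `α ↦ √a ∈ K = ℚ(√a) ⊂ 𝔻`, the Weil discriminant of `(V = 𝔻², E_T, K)` is
`δ_K = [det Ψ] = [Nrd T] = [disc T] ∈ ℚˣ/Nm(Kˣ)` for EVERY imaginary quadratic `K ⊂ 𝔻` and every `𝔻`-basis of `V`.
research route conditional on HC_CM; not a corollary; Q11.4-sentence-2 already refuted in dim ≥ 3. [cite: vanGeemen1994HodgeAV, Lemma 5.2 (3) and (5.4.1)] -/
theorem typeIII_weilGram_det (α c p₁ q₁ r₁ p₂ q₂ r₂ g₀ g₁ g₂ g₃ : R) :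
    Matrix.det !![2*α^2*p₁, -2*α^2*c*r₁ - 2*α*c*q₁, 2*α^2*g₁ + 2*α*g₀, -2*α^2*c*g₃ - 2*α*c*g₂;
         -2*α^2*c*r₁ + 2*α*c*q₁, 2*α^2*c*p₁, -2*α^2*c*g₃ + 2*α*c*g₂, 2*α^2*c*g₁ - 2*α*c*g₀;
         2*α^2*g₁ - 2*α*g₀, -2*α^2*c*g₃ - 2*α*c*g₂, 2*α^2*p₂, -2*α^2*c*r₂ - 2*α*c*q₂;
         -2*α^2*c*g₃ + 2*α*c*g₂, 2*α^2*c*g₁ + 2*α*c*g₀, -2*α^2*c*r₂ + 2*α*c*q₂, 2*α^2*c*p₂] =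
      16 * α^4 * c^2 *
        ((((⟨0, p₁, q₁, r₁⟩ : ℍ[R,α^2,c]) * star ⟨0, p₁, q₁, r₁⟩).re) * (((⟨0, p₂, q₂, r₂⟩ : ℍ[R,α^2,c]) * star ⟨0, p₂, q₂, r₂⟩).re) +
          (((⟨g₀, g₁, g₂, g₃⟩ : ℍ[R,α^2,c]) * star ⟨g₀, g₁, g₂, g₃⟩).re) ^ 2 +
          2 * ((⟨0, p₂, q₂, r₂⟩ : ℍ[R,α^2,c]) * star ⟨g₀, g₁, g₂, g₃⟩ * ⟨0, p₁, q₁, r₁⟩ * ⟨g₀, g₁, g₂, g₃⟩).re) := by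
  rw [det_fin_four]
  simp
  ring

/-- The same determinant in plain coordinates: `det Ψ = (4 α² c)² · N`, `N = Nrd β₁ Nrd β₂ + Nrd(γ)² + Trd(β₂ γ̄ β₁ γ)` written out
(`Nrd(x) = x₀² - a x₁² - c x₂² + a c x₃²`, `a = α²`) — **`det Ψ` and `Nrd(T)` differ by a SQUARE, so they have the same class in
`ℚˣ/Nm(Kˣ) ⊇ ℚˣ²`**. research route conditional on HC_CM; not a corollary; Q11.4-sentence-2 already refuted in dim ≥ 3. [cite: vanGeemen1994HodgeAV, (5.4.1)] -/
theorem typeIII_weilGram_det_eq_sq_mul (α c p₁ q₁ r₁ p₂ q₂ r₂ g₀ g₁ g₂ g₃ : R) :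
    Matrix.det !![2*α^2*p₁, -2*α^2*c*r₁ - 2*α*c*q₁, 2*α^2*g₁ + 2*α*g₀, -2*α^2*c*g₃ - 2*α*c*g₂;
         -2*α^2*c*r₁ + 2*α*c*q₁, 2*α^2*c*p₁, -2*α^2*c*g₃ + 2*α*c*g₂, 2*α^2*c*g₁ - 2*α*c*g₀;
         2*α^2*g₁ - 2*α*g₀, -2*α^2*c*g₃ - 2*α*c*g₂, 2*α^2*p₂, -2*α^2*c*r₂ - 2*α*c*q₂;
         -2*α^2*c*g₃ + 2*α*c*g₂, 2*α^2*c*g₁ + 2*α*c*g₀, -2*α^2*c*r₂ + 2*α*c*q₂, 2*α^2*c*p₂] =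
      (4 * α^2 * c) ^ 2 *
        ((-α^2*p₁^2 - c*q₁^2 + α^2*c*r₁^2) * (-α^2*p₂^2 - c*q₂^2 + α^2*c*r₂^2) +
          (g₀^2 - α^2*g₁^2 - c*g₂^2 + α^2*c*g₃^2) ^ 2 +
          2 * ((⟨0, p₂, q₂, r₂⟩ : ℍ[R,α^2,c]) * star ⟨g₀, g₁, g₂, g₃⟩ * ⟨0, p₁, q₁, r₁⟩ * ⟨g₀, g₁, g₂, g₃⟩).re) := by
  rw [typeIII_weilGram_det]
  simp
  ring

/-- **Diagonal frame** (`γ = 0`, `T = β₁ ⊥ β₂`): `det Ψ = (4 α² c · Nrd β₁)(4 α² c · Nrd β₂)` — LEMMA CK's block identity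
`lemmaCK_block_det` (there `n = -α²`, signs absorbed) twice. research route conditional on HC_CM; not a corollary; Q11.4-sentence-2 already refuted in dim ≥ 3. [cite: vanGeemen1994HodgeAV, Lemma 5.2] -/
theorem typeIII_weilGram_det_diag (α c p₁ q₁ r₁ p₂ q₂ r₂ : R) :
    Matrix.det !![2*α^2*p₁, -2*α^2*c*r₁ - 2*α*c*q₁, 0, 0;
         -2*α^2*c*r₁ + 2*α*c*q₁, 2*α^2*c*p₁, 0, 0;
         0, 0, 2*α^2*p₂, -2*α^2*c*r₂ - 2*α*c*q₂;
         0, 0, -2*α^2*c*r₂ + 2*α*c*q₂, 2*α^2*c*p₂] =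
      (4 * α^2 * c * (-α^2*p₁^2 - c*q₁^2 + α^2*c*r₁^2)) * (4 * α^2 * c * (-α^2*p₂^2 - c*q₂^2 + α^2*c*r₂^2)) := by
  rw [det_fin_four]
  simp
  ring

/-! ### §4 The three simple type-III members of the quasiplatonic census (b03.40 γ): carriers and rows -/

/-- **#10 `(10; 2,4,5,5,6,8)`, `𝔻 = D_{5,∞} ≅ (-2,-5)_ℚ` contains `√-3`**: `((i + k)/2)² = -3` — the hypothesis «`End⁰ X ∋ √-3`» of
Abdulali's Corollary 4.3 (general Hodge conjecture for all powers of a simple type-III fourfold). research route conditional on HC_CM; not a corollary; Q11.4-sentence-2 already refuted in dim ≥ 3. [cite: Abdulali2002TypeIII, Cor. 4.3] -/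
theorem typeIII_member10_sqrtNeg3 :
    (⟨0, 1/2, 0, 1/2⟩ : ℍ[ℚ,-2,-5]) * ⟨0, 1/2, 0, 1/2⟩ = ⟨-3, 0, 0, 0⟩ := by
  ext <;> norm_num

/-- #10: `𝔻 = (-2,-5)_ℚ` contains `√-5` (`j² = -5`) and `√-2` (`i² = -2`). research route conditional on HC_CM; not a corollary; Q11.4-sentence-2 already refuted in dim ≥ 3. [cite: MoonenZarhin1999LowDim, Thm. 0.1 (2)] -/
theorem typeIII_member10_sqrtNeg5_sqrtNeg2 :
    (⟨0, 0, 1, 0⟩ : ℍ[ℚ,-2,-5]) * ⟨0, 0, 1, 0⟩ = ⟨-5, 0, 0, 0⟩ ∧ (⟨0, 1, 0, 0⟩ : ℍ[ℚ,-2,-5]) * ⟨0, 1, 0, 0⟩ = ⟨-2, 0, 0, 0⟩ := by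
  constructor <;> ext <;> norm_num

/-- **#26 `(12; 2,3,6,6,9,10)`, `𝔻 = D_{3,∞} ≅ (-1,-3)_ℚ` contains `√-3` (`j`) and `√-1` (`i`).**
research route conditional on HC_CM; not a corollary; Q11.4-sentence-2 already refuted in dim ≥ 3. [cite: Abdulali2002TypeIII, Cor. 4.3] -/
theorem typeIII_member26_sqrtNeg3_sqrtNeg1 :
    (⟨0, 0, 1, 0⟩ : ℍ[ℚ,-1,-3]) * ⟨0, 0, 1, 0⟩ = ⟨-3, 0, 0, 0⟩ ∧ (⟨0, 1, 0, 0⟩ : ℍ[ℚ,-1,-3]) * ⟨0, 1, 0, 0⟩ = ⟨-1, 0, 0, 0⟩ := by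
  constructor <;> ext <;> norm_num

/-- **#29 `(12; 3,4,6,6,8,9)`, `𝔻 = D_{2,∞} ≅ (-1,-1)_ℚ` (Hamilton) contains `√-3` (`i + j + k`), `√-1` (`i`), `√-2` (`i + j`),
`√-6` (`i + j + 2k`) and `√-5` (`2i + k`).** research route conditional on HC_CM; not a corollary; Q11.4-sentence-2 already refuted in dim ≥ 3. [cite: Abdulali2002TypeIII, Cor. 4.3] -/
theorem typeIII_member29_sqrts :
    (⟨0, 1, 1, 1⟩ : ℍ[ℚ,-1,-1]) * ⟨0, 1, 1, 1⟩ = ⟨-3, 0, 0, 0⟩ ∧ (⟨0, 1, 0, 0⟩ : ℍ[ℚ,-1,-1]) * ⟨0, 1, 0, 0⟩ = ⟨-1, 0, 0, 0⟩ ∧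
      (⟨0, 1, 1, 0⟩ : ℍ[ℚ,-1,-1]) * ⟨0, 1, 1, 0⟩ = ⟨-2, 0, 0, 0⟩ ∧ (⟨0, 1, 1, 2⟩ : ℍ[ℚ,-1,-1]) * ⟨0, 1, 1, 2⟩ = ⟨-6, 0, 0, 0⟩ ∧
      (⟨0, 2, 0, 1⟩ : ℍ[ℚ,-1,-1]) * ⟨0, 2, 0, 1⟩ = ⟨-5, 0, 0, 0⟩ := by
  refine ⟨?_, ?_, ?_, ?_, ?_⟩ <;> ext <;> norm_num

/-- **#10 on the fourfold table: row `(2, ℚ(√-5), [5])` is the SPLIT row** (`δ_{ℚ(√-5)}(X₁₀) = [disc T] = [5] = [0² + 5·1²] = 1`):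
the discriminant-1 Weil structure of `X₁₀` is carried by `K = ℚ(√-5) ⊂ D_{5,∞}`.
research route conditional on HC_CM; not a corollary; Q11.4-sentence-2 already refuted in dim ≥ 3. [cite: Markman2023GeneralizedKummers, Thm. 1.3] -/
theorem typeIII_member10_sqrtNeg5_mk_eq_split :
    (QuotientGroup.mk (Units.mk0 (5 : ℚ) (by norm_num)) : weilNormResidueGroup 5) = splitDiscriminantClass 2 5 :=
  mk_eq_split_of_even (by decide) _ (mem_normUnitsSubgroup_of_sq_add_mul_sq _ 0 1 (by norm_num))

/-- **#10: row `(2, ℚ(√-3), [5])` is NOT split** (`5 ∉ Nm ℚ(√-3)ˣ`, ring2-b02's `five_not_mem_norm_three`): Abdulali's route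
through `√-3 ∈ D_{5,∞}` uses Schoen's `ℚ(√-3)` theorem at a NON-trivial discriminant.
research route conditional on HC_CM; not a corollary; Q11.4-sentence-2 already refuted in dim ≥ 3. [cite: vanGeemen1994HodgeAV, (5.4.1)] -/
theorem typeIII_member10_sqrtNeg3_mk_ne_split :
    (QuotientGroup.mk (Units.mk0 (5 : ℚ) (by norm_num)) : weilNormResidueGroup 3) ≠ splitDiscriminantClass 2 3 :=
  mk_ne_split_of_even (by decide) _ Summit.HodgeConjecture.Ring2WeilNormDescent.five_not_mem_norm_three

/-- **#26: row `(2, ℚ(√-1), [2])` is the SPLIT row** (`2 = 1² + 1·1²`; `ℚ(i) ⊂ D_{3,∞}`): `δ_{ℚ(i)}(X₂₆) = 1`.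
research route conditional on HC_CM; not a corollary; Q11.4-sentence-2 already refuted in dim ≥ 3. [cite: Markman2023GeneralizedKummers, Thm. 1.3] -/
theorem typeIII_member26_sqrtNeg1_mk_eq_split :
    (QuotientGroup.mk (Units.mk0 (2 : ℚ) (by norm_num)) : weilNormResidueGroup 1) = splitDiscriminantClass 2 1 :=
  mk_eq_split_of_even (by decide) _ SqrtNeg1.mem_2

-- #26: row `(2, ℚ(√-3), [2])` is NOT split (`2 ∉ Nm ℚ(√-3)ˣ`, ring2-b02's `two_not_mem_norm_three`): ALREADY in the tree as the
-- proposition `Ring2.WeilCoverage.SigmaDataWeilRowsB.twoA6_eta_8_4_8_7_3_3_3_3_o1_gram_ne_split` (`Ring2WeilCoverageSigmaDataWeilRowsB.lean`,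
-- the same class `[2] ≠ splitDiscriminantClass 2 3`) — reused by name in census block b03.42, not restated.

/-- **#29: rows `(2, ℚ(√-2), [6])`, `(2, ℚ(√-5), [6])`, `(2, ℚ(√-6), [6])` are SPLIT** (`6 = 2² + 2·1² = 1² + 5·1² = 0² + 6·1²`;
all three fields lie in `D_{2,∞}`): three discriminant-1 Weil structures on `X₂₉`.
research route conditional on HC_CM; not a corollary; Q11.4-sentence-2 already refuted in dim ≥ 3. [cite: Markman2023GeneralizedKummers, Thm. 1.3] -/
theorem typeIII_member29_mk_eq_split :
    (QuotientGroup.mk (Units.mk0 (6 : ℚ) (by norm_num)) : weilNormResidueGroup 2) = splitDiscriminantClass 2 2 ∧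
      (QuotientGroup.mk (Units.mk0 (6 : ℚ) (by norm_num)) : weilNormResidueGroup 5) = splitDiscriminantClass 2 5 ∧
      (QuotientGroup.mk (Units.mk0 (6 : ℚ) (by norm_num)) : weilNormResidueGroup 6) = splitDiscriminantClass 2 6 :=
  ⟨mk_eq_split_of_even (by decide) _ SqrtNeg2.mem_6,
    mk_eq_split_of_even (by decide) _ (mem_normUnitsSubgroup_of_sq_add_mul_sq _ 1 1 (by norm_num)),
    mk_eq_split_of_even (by decide) _ (mem_normUnitsSubgroup_of_sq_add_mul_sq _ 0 1 (by norm_num))⟩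

/-- **#29: rows `(2, ℚ(√-1), [6])` and `(2, ℚ(√-3), [6])` are NOT split** (`6 ∉ Nm ℚ(i)ˣ`, `6 ∉ Nm ℚ(√-3)ˣ`: ring2-b04's
`SqrtNeg1.not_mem_6`, `SqrtNeg3.not_mem_6`) — both printed routes of [Abdulali 2016, App. A 2(a)] (`√-1`, `√-3 ∈ D_{2,∞}`) run
through NON-trivial discriminants here (Koike ∕ Schoen). research route conditional on HC_CM; not a corollary; Q11.4-sentence-2 already refuted in dim ≥ 3. [cite: Abdulali2016TateTwists, Appendix A 2(a)] -/
theorem typeIII_member29_mk_ne_split :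
    (QuotientGroup.mk (Units.mk0 (6 : ℚ) (by norm_num)) : weilNormResidueGroup 1) ≠ splitDiscriminantClass 2 1 ∧
      (QuotientGroup.mk (Units.mk0 (6 : ℚ) (by norm_num)) : weilNormResidueGroup 3) ≠ splitDiscriminantClass 2 3 :=
  ⟨mk_ne_split_of_even (by decide) _ SqrtNeg1.not_mem_6, mk_ne_split_of_even (by decide) _ SqrtNeg3.not_mem_6⟩

end TypeIIIDisc

end Summit.HodgeConjecture.HodgeConjecture.Ring2.WeilCoverageCM

end
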